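import Mathlib.Algebra.Group.Units.Equiv
import Mathlib.Logic.Equiv.Sum
import Literature.InformationTheory.QuantumCodes.BivariateBicycleCodes
import Literature.InformationTheory.QuantumCodes.OrbitReduction
import HarnessLib

/-!
# Translation-orbit reduction for abelian two-block / bivariate-bicycle codes

For the abelian two-block check matrices `H_X = [A | B]`, `H_Z = [Bᵀ | Aᵀ]`, `A = circulant a`,
`B = circulant b` on the qubit set `G ⊕ G` (`AbelianTwoBlockCodes.lean`; `G` a finite additive
commutative group; bivariate-bicycle codes `QC(A, B)` of [BravyiEtAl2024, §4]: `G = ℤ_ℓ × ℤ_m`,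
`BivariateBicycleCodes.lean`), the translation
`inl x ↦ inl (x + g), inr x ↦ inr (x + g)` (`Equiv.sumCongr (Equiv.addRight g) (Equiv.addRight g)`;
for BB codes this is `BB.Code.translate g`) of BOTH blocks by the same group element is a permutation
automorphism of `H_X` and of `H_Z` with check permutation `i ↦ i + g` (`HX_submatrix_addRight`,
`HZ_submatrix_addRight`; BB form `BB.Code.HX_submatrix_translate`): [BravyiEtAl2024, SI §9.2 "Logical
gates based on automorphisms"]: "the stabilizers are transformed as `X(αA, αB) → X(α s A, α s B)`,
which is the same as permuting the `X` checks by `α → α s` … The `Z` stabilizers are also permuted …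
this only works because the `q(L)` and `q(R)` blocks were transformed by the same `s` … we can perform
all translations of the tori containing `q(L)`, `q(R)`"; [LinPryadko2024, §4.4 "Symmetry group of a
2BGA code"]: "if a pair `[u,v]` is in the code, then the corresponding left-multiplied pair `[gu,gv]`
is also in the code".  The two blocks are the two translation orbits, with base points `inl 0`,
`inr 0` (`exists_sumCongr_addRight_mem_base`), whence — by the ordered-block orbit reduction of
`OrbitReduction.lean` — the **pinning disjunction** consumed by the venture's distance certificates
(LADDER-QEC CERT-FORMAT `mitm_sym`; kernel-B enc-v2 case split "case 0: qubit `(L,0)` ∈ supp;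
case 1: supp ⊆ `R` ∧ qubit `(R,0)` ∈ supp"): every `Z`-logical (`H_X v = 0`, `v ∉ rs H_Z`) may be
replaced by one with the same two properties and the same weight such that

`v (inl 0) ≠ 0 ∨ ((∀ x, v (inl x) = 0) ∧ v (inr 0) ≠ 0)`

(`AbelianTwoBlock.exists_zLogical_pinned`; `X`-side `exists_xLogical_pinned`; both from the
matrix-generic `exists_logical_pinned` for any pair of translation-invariant check matrices on
`G ⊕ G`), so a lower bound `d ≤ |v|` verified on pinned logicals only holds for all of them
(`le_hammingNorm_zLogical_of_pinned`), and "a `Z`-logical of weight `≤ w` exists iff a pinned one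
does" (`exists_zLogical_hammingNorm_le_iff_pinned`).  For BB codes `C : BB.Code ℓ m` the same is
restated on `C.HX`, `C.HZ`, `C.css.dZ`, `C.d` (`BB.Code.exists_zLogical_pinned`,
`BB.Code.le_dZ_of_pinned`, **`BB.Code.dZ_eq_of_pinned_witness`**, **`BB.Code.d_eq_of_pinned_witness`**:
an explicit `Z`-logical of weight `d` + "every PINNED `Z`-logical has weight `≥ d`" gives the distance
`d` of `QC(A,B)`, using `d = d^Z = d^X` of [BravyiEtAl2024, Lemma 1]).  For `[[72,12,6]]` this cuts the
weight-`5` patterns a lower-bound certificate must exclude from `C(72,5) = 13 991 544` to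
`C(71,4) + C(35,4) = 1 024 345`; it is the hypothesis «assumes: TranslationOrbit» of the pinned
certificates, now a theorem.

Everything here is PROVED; no named facts, no new definitions.

## References
* [BravyiEtAl2024] S. Bravyi et al., Nature 627 (2024) 778–782 = arXiv:2308.07915, §4 (BB codes) and
  Supplementary Information §9.2 (held text chunk p0021 L58–62, p0022 L8–12).
* [LinPryadko2024] H.-K. Lin, L. P. Pryadko, PRA 109 (2024) 022407 = arXiv:2306.16400, §4.4 (held text
  chunk p0010 L84–96).

## Mathlib / tree search (2026-08-26)
Mathlib: `Equiv.addRight`, `Equiv.sumCongr`, `Matrix.circulant_apply`; tree (reused): `AbelianTwoBlock.HX/HZ`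
(`AbelianTwoBlockCodes.lean`), `BB.Code`, `BB.Code.css`, `BB.Code.translate`, `BB.Code.HX_translate`,
`BB.Code.d_eq_dZ` (`BivariateBicycleCodes.lean`), `rowSpace` (`HypergraphProduct.lean`), `CSSCode.le_dZ`,
`CSSCode.dZ_le_hammingNorm` (`CSS.lean`), the generic orbit lemmas (`OrbitReduction.lean`).
-/

namespace Literature.InformationTheory.QuantumCodes

open Matrix

/-! ### Two-block codes on `G ⊕ G`: the diagonal translation group -/

namespace AbelianTwoBlock

variable {G : Type*} [AddCommGroup G] {R : Type*}

/-- Every qubit is translated to the base qubit of its block: translating by `-x` sends `inl x ↦ inl 0`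
and `inr x ↦ inr 0`; so `{inl 0, inr 0}` is a transversal of the two translation orbits (the blocks
`q(L)`, `q(R)`). [cite: BravyiEtAl2024, SI §9.2 "translations of the tori containing q(L), q(R)" (arXiv:2308.07915, chunk p0022 L12)] -/
theorem exists_sumCongr_addRight_mem_base (q : G ⊕ G) :
    ∃ g : G, Equiv.sumCongr (Equiv.addRight g) (Equiv.addRight g) q ∈
      ({Sum.inl 0, Sum.inr 0} : Set (G ⊕ G)) := by
  rcases q with x | x
  · exact ⟨-x, by simp⟩
  · exact ⟨-x, by simp⟩

/-- Translations preserve the block of a qubit (block label `L ↦ 0`, `R ↦ 1`).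
[cite: BravyiEtAl2024, SI §9.2 (arXiv:2308.07915, chunk p0022 L8–12)] -/
theorem blockLabel_sumCongr_addRight (g : G) (q : G ⊕ G) :
    Sum.elim (fun _ => (0 : ℕ)) (fun _ => 1) (Equiv.sumCongr (Equiv.addRight g) (Equiv.addRight g) q) =
      Sum.elim (fun _ => (0 : ℕ)) (fun _ => 1) q := by
  cases q <;> rfl

/-- **Translations are automorphisms of `H_X = [A | B]`**: translating both qubit blocks by `g` and the
checks by `g` leaves `H_X` entrywise fixed, `H_X (i + g) (q + g) = H_X i q`, because `A = circulant a`,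
`B = circulant b` are `G`-circulant (`A (i+g) (j+g) = a (i - j) = A i j`).
[cite: BravyiEtAl2024, SI §9.2 "the stabilizers are transformed as X(αA, αB) → X(α A_j A_k^T A, α A_j A_k^T B), which is the same as permuting the X checks" (arXiv:2308.07915, chunk p0022 L8)] -/
theorem HX_submatrix_addRight (a b : G → R) (g : G) :
    (HX a b).submatrix (Equiv.addRight g) (Equiv.sumCongr (Equiv.addRight g) (Equiv.addRight g)) =
      HX a b := by
  ext i j
  rcases j with j | j
  · simp [HX, circulant_apply, add_sub_add_right_eq_sub]
  · simp [HX, circulant_apply, add_sub_add_right_eq_sub]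

/-- **Translations are automorphisms of `H_Z = [Bᵀ | Aᵀ]`** (same check permutation `i ↦ i + g`).
[cite: BravyiEtAl2024, SI §9.2 "The Z stabilizers are also permuted by α → α A_j A_k^T" (arXiv:2308.07915, chunk p0022 L8)] -/
theorem HZ_submatrix_addRight (a b : G → R) (g : G) :
    (HZ a b).submatrix (Equiv.addRight g) (Equiv.sumCongr (Equiv.addRight g) (Equiv.addRight g)) =
      HZ a b := by
  ext i j
  rcases j with j | j
  · simp [HZ, circulant_apply, add_sub_add_right_eq_sub]
  · simp [HZ, circulant_apply, add_sub_add_right_eq_sub]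

section Pinned

variable [Fintype G] {F : Type*} [Field F] [DecidableEq F]

/-- **Orbit reduction for codes on two translation-symmetric blocks** (generic in the check matrices):
if `H₁`, `H₂` on the qubit set `G ⊕ G` are both invariant, up to a check permutation, under every
diagonal translation `inl x ↦ inl (x+g), inr x ↦ inr (x+g)`, then every logical operator of type
"`H₁ v = 0`, `v ∉ rs H₂`" may be replaced by one of the same weight which EITHER contains the base
qubit `inl 0` of the left block, OR is supported on the right block and contains its base qubit
`inr 0` — the pinning disjunction of the venture's distance certificates.
[cite: BravyiEtAl2024, SI §9.2 (arXiv:2308.07915, chunk p0021 L60 – p0022 L12)] -/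
theorem exists_logical_pinned {r₁ r₂ : Type*} [Fintype r₁] [Fintype r₂]
    {H₁ : Matrix r₁ (G ⊕ G) F} {H₂ : Matrix r₂ (G ⊕ G) F}
    (h₁ : ∀ g : G, ∃ ρ : r₁ ≃ r₁,
      H₁.submatrix ρ (Equiv.sumCongr (Equiv.addRight g) (Equiv.addRight g)) = H₁)
    (h₂ : ∀ g : G, ∃ ρ : r₂ ≃ r₂,
      H₂.submatrix ρ (Equiv.sumCongr (Equiv.addRight g) (Equiv.addRight g)) = H₂)
    {v : G ⊕ G → F} (hv : H₁ *ᵥ v = 0) (hv' : v ∉ rowSpace H₂) :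
    ∃ v' : G ⊕ G → F, H₁ *ᵥ v' = 0 ∧ v' ∉ rowSpace H₂ ∧ hammingNorm v' = hammingNorm v ∧
      (v' (Sum.inl 0) ≠ 0 ∨ ((∀ x, v' (Sum.inl x) = 0) ∧ v' (Sum.inr 0) ≠ 0)) := by
  have hS : ∀ σ ∈ Set.range (fun g : G => Equiv.sumCongr (Equiv.addRight g) (Equiv.addRight g)),
      ∀ w ∈ {w : G ⊕ G → F | H₁ *ᵥ w = 0 ∧ w ∉ rowSpace H₂},
      w ∘ σ.symm ∈ {w : G ⊕ G → F | H₁ *ᵥ w = 0 ∧ w ∉ rowSpace H₂} := by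
    rintro _ ⟨g, rfl⟩ w hw
    obtain ⟨ρ₁, hρ₁⟩ := h₁ g
    obtain ⟨ρ₂, hρ₂⟩ := h₂ g
    exact (isLogical_comp_equiv_symm_iff hρ₁ hρ₂ w).2 hw
  have hT : ∀ q : G ⊕ G,
      ∃ σ ∈ Set.range (fun g : G => Equiv.sumCongr (Equiv.addRight g) (Equiv.addRight g)),
      σ q ∈ ({Sum.inl 0, Sum.inr 0} : Set (G ⊕ G)) := fun q => by
    obtain ⟨g, hg⟩ := exists_sumCongr_addRight_mem_base q
    exact ⟨_, ⟨g, rfl⟩, hg⟩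
  have hblk : ∀ σ ∈ Set.range (fun g : G => Equiv.sumCongr (Equiv.addRight g) (Equiv.addRight g)),
      ∀ q : G ⊕ G,
      Sum.elim (fun _ => (0 : ℕ)) (fun _ => 1) (σ q) = Sum.elim (fun _ => (0 : ℕ)) (fun _ => 1) q := by
    rintro _ ⟨g, rfl⟩ q
    exact blockLabel_sumCongr_addRight g q
  have hv0 : v ≠ 0 := by
    rintro rfl
    exact hv' (Submodule.zero_mem _)
  obtain ⟨v', ⟨hv'₁, hv'₂⟩, hwt, t, ht, hvt, hmin⟩ :=
    exists_mem_apply_ne_zero_min_block hS (Sum.elim (fun _ => (0 : ℕ)) (fun _ => 1)) hblk hT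
      (v := v) ⟨hv, hv'⟩ hv0
  refine ⟨v', hv'₁, hv'₂, hwt, ?_⟩
  simp only [Set.mem_insert_iff, Set.mem_singleton_iff] at ht
  rcases ht with rfl | rfl
  · exact Or.inl hvt
  · refine Or.inr ⟨fun x => ?_, hvt⟩
    by_contra hx
    have := hmin (Sum.inl x) hx
    simp at this

/-- **Pinning disjunction for `Z`-logicals of an abelian two-block code** `H_X = [A|B]`,
`H_Z = [Bᵀ|Aᵀ]` (`A = circulant a`, `B = circulant b` over the finite abelian group `G`; BB codes:
`G = ℤ_ℓ × ℤ_m`): every `v` with `H_X v = 0`, `v ∉ rs H_Z` may be replaced by `v'` with the same two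
properties and the same weight such that `v' (inl 0) ≠ 0 ∨ ((∀ x, v' (inl x) = 0) ∧ v' (inr 0) ≠ 0)`.
In particular a minimum-weight `Z`-logical may be assumed pinned.
[cite: BravyiEtAl2024, SI §9.2 (arXiv:2308.07915, chunk p0021 L60 – p0022 L12)] -/
theorem exists_zLogical_pinned (a b : G → F) {v : G ⊕ G → F} (hv : HX a b *ᵥ v = 0)
    (hv' : v ∉ rowSpace (HZ a b)) :
    ∃ v' : G ⊕ G → F, HX a b *ᵥ v' = 0 ∧ v' ∉ rowSpace (HZ a b) ∧
      hammingNorm v' = hammingNorm v ∧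
      (v' (Sum.inl 0) ≠ 0 ∨ ((∀ x, v' (Sum.inl x) = 0) ∧ v' (Sum.inr 0) ≠ 0)) :=
  exists_logical_pinned (fun g => ⟨Equiv.addRight g, HX_submatrix_addRight a b g⟩)
    (fun g => ⟨Equiv.addRight g, HZ_submatrix_addRight a b g⟩) hv hv'

/-- **Pinning disjunction for `X`-logicals** (`H_Z v = 0`, `v ∉ rs H_X`) of an abelian two-block code.
[cite: BravyiEtAl2024, SI §9.2 (arXiv:2308.07915, chunk p0021 L60 – p0022 L12)] -/
theorem exists_xLogical_pinned (a b : G → F) {v : G ⊕ G → F} (hv : HZ a b *ᵥ v = 0)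
    (hv' : v ∉ rowSpace (HX a b)) :
    ∃ v' : G ⊕ G → F, HZ a b *ᵥ v' = 0 ∧ v' ∉ rowSpace (HX a b) ∧
      hammingNorm v' = hammingNorm v ∧
      (v' (Sum.inl 0) ≠ 0 ∨ ((∀ x, v' (Sum.inl x) = 0) ∧ v' (Sum.inr 0) ≠ 0)) :=
  exists_logical_pinned (fun g => ⟨Equiv.addRight g, HZ_submatrix_addRight a b g⟩)
    (fun g => ⟨Equiv.addRight g, HX_submatrix_addRight a b g⟩) hv hv'

/-- **A lower bound on `Z`-logical weights may be checked on pinned vectors only**: if every `v` with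
`H_X v = 0`, `v ∉ rs H_Z` and (`v (inl 0) ≠ 0` or (`v` vanishes on the left block and `v (inr 0) ≠ 0`))
has weight `≥ d`, then every `Z`-logical has weight `≥ d` — the hypothesis shape of
`CSSCode.le_dZ` / `CSSCode.dZ_eq_of_witness` for the two-block check matrices.
[cite: BravyiEtAl2024, SI §9.2 (arXiv:2308.07915, chunk p0021 L60 – p0022 L12)] -/
theorem le_hammingNorm_zLogical_of_pinned (a b : G → F) {d : ℕ}
    (h : ∀ v : G ⊕ G → F, HX a b *ᵥ v = 0 → v ∉ rowSpace (HZ a b) →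
      (v (Sum.inl 0) ≠ 0 ∨ ((∀ x, v (Sum.inl x) = 0) ∧ v (Sum.inr 0) ≠ 0)) → d ≤ hammingNorm v)
    (v : G ⊕ G → F) (hv : HX a b *ᵥ v = 0) (hv' : v ∉ rowSpace (HZ a b)) : d ≤ hammingNorm v := by
  obtain ⟨v', h₁, h₂, hwt, hpin⟩ := exists_zLogical_pinned a b hv hv'
  rw [← hwt]
  exact h v' h₁ h₂ hpin

/-- **A lower bound on `X`-logical weights may be checked on pinned vectors only.**
[cite: BravyiEtAl2024, SI §9.2 (arXiv:2308.07915, chunk p0021 L60 – p0022 L12)] -/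
theorem le_hammingNorm_xLogical_of_pinned (a b : G → F) {d : ℕ}
    (h : ∀ v : G ⊕ G → F, HZ a b *ᵥ v = 0 → v ∉ rowSpace (HX a b) →
      (v (Sum.inl 0) ≠ 0 ∨ ((∀ x, v (Sum.inl x) = 0) ∧ v (Sum.inr 0) ≠ 0)) → d ≤ hammingNorm v)
    (v : G ⊕ G → F) (hv : HZ a b *ᵥ v = 0) (hv' : v ∉ rowSpace (HX a b)) : d ≤ hammingNorm v := by
  obtain ⟨v', h₁, h₂, hwt, hpin⟩ := exists_xLogical_pinned a b hv hv'
  rw [← hwt]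
  exact h v' h₁ h₂ hpin

/-- Existence form (weight `≤ w`), `Z`-side: a `Z`-logical of weight `≤ w` exists iff a PINNED one does —
the statement a SAT/enumeration certificate of "no `Z`-logical of weight `≤ d − 1`" is split along.
[cite: BravyiEtAl2024, SI §9.2 (arXiv:2308.07915, chunk p0021 L60 – p0022 L12)] -/
theorem exists_zLogical_hammingNorm_le_iff_pinned (a b : G → F) (w : ℕ) :
    (∃ v : G ⊕ G → F, HX a b *ᵥ v = 0 ∧ v ∉ rowSpace (HZ a b) ∧ hammingNorm v ≤ w) ↔
      ∃ v : G ⊕ G → F, HX a b *ᵥ v = 0 ∧ v ∉ rowSpace (HZ a b) ∧ hammingNorm v ≤ w ∧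
        (v (Sum.inl 0) ≠ 0 ∨ ((∀ x, v (Sum.inl x) = 0) ∧ v (Sum.inr 0) ≠ 0)) := by
  constructor
  · rintro ⟨v, hv, hv', hw⟩
    obtain ⟨v', h₁, h₂, hwt, hpin⟩ := exists_zLogical_pinned a b hv hv'
    exact ⟨v', h₁, h₂, hwt ▸ hw, hpin⟩
  · rintro ⟨v, hv, hv', hw, -⟩
    exact ⟨v, hv, hv', hw⟩

/-- Existence form (weight `≤ w`), `X`-side. [cite: BravyiEtAl2024, SI §9.2 (arXiv:2308.07915, chunk p0021 L60 – p0022 L12)] -/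
theorem exists_xLogical_hammingNorm_le_iff_pinned (a b : G → F) (w : ℕ) :
    (∃ v : G ⊕ G → F, HZ a b *ᵥ v = 0 ∧ v ∉ rowSpace (HX a b) ∧ hammingNorm v ≤ w) ↔
      ∃ v : G ⊕ G → F, HZ a b *ᵥ v = 0 ∧ v ∉ rowSpace (HX a b) ∧ hammingNorm v ≤ w ∧
        (v (Sum.inl 0) ≠ 0 ∨ ((∀ x, v (Sum.inl x) = 0) ∧ v (Sum.inr 0) ≠ 0)) := by
  constructor
  · rintro ⟨v, hv, hv', hw⟩
    obtain ⟨v', h₁, h₂, hwt, hpin⟩ := exists_xLogical_pinned a b hv hv'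
    exact ⟨v', h₁, h₂, hwt ▸ hw, hpin⟩
  · rintro ⟨v, hv, hv', hw, -⟩
    exact ⟨v, hv, hv', hw⟩

end Pinned

end AbelianTwoBlock

/-! ### Bivariate-bicycle codes `QC(A, B)` on `ℤ_ℓ × ℤ_m` (`BB.Code`) -/

namespace BB.Code

variable {ℓ m : ℕ} [NeZero ℓ] [NeZero m] (C : Code ℓ m)

/-- The BB translation `BB.Code.translate t` is the diagonal translation of both blocks by `t`.
[cite: BravyiEtAl2024, SI §9.2 (arXiv:2308.07915, chunk p0022 L12)] -/
theorem translate_eq_sumCongr (t : Mono ℓ m) :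
    translate t = Equiv.sumCongr (Equiv.addRight t) (Equiv.addRight t) := rfl

/-- Translation by `t` (qubits of both blocks and checks) is a permutation automorphism of `H^X` of
`QC(A,B)`: `H^X.submatrix (· + t) (translate t) = H^X`.
[cite: BravyiEtAl2024, SI §9.2 (arXiv:2308.07915, chunk p0022 L8–12)] -/
theorem HX_submatrix_translate (t : Mono ℓ m) :
    C.HX.submatrix (Equiv.addRight t) (translate t) = C.HX := by
  ext i q
  simp [HX_translate]

/-- Translation by `t` is a permutation automorphism of `H^Z` of `QC(A,B)`.
[cite: BravyiEtAl2024, SI §9.2 (arXiv:2308.07915, chunk p0022 L8–12)] -/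
theorem HZ_submatrix_translate (t : Mono ℓ m) :
    C.HZ.submatrix (Equiv.addRight t) (translate t) = C.HZ := by
  ext i q
  simp [HZ_translate]

/-- **Translation-orbit lemma for `QC(A, B)`, `Z`-side**: every `Z`-logical (`H^X v = 0`,
`v ∉ rs H^Z`) may be replaced by one of the same weight containing qubit `(L, (0,0))`, or supported
on block `R` and containing qubit `(R, (0,0))`.
[cite: BravyiEtAl2024, SI §9.2 (arXiv:2308.07915, chunk p0021 L60 – p0022 L12)] -/
theorem exists_zLogical_pinned {v : Mono ℓ m ⊕ Mono ℓ m → ZMod 2} (hv : C.HX *ᵥ v = 0)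
    (hv' : v ∉ rowSpace C.HZ) :
    ∃ v', C.HX *ᵥ v' = 0 ∧ v' ∉ rowSpace C.HZ ∧ hammingNorm v' = hammingNorm v ∧
      (v' (Sum.inl 0) ≠ 0 ∨ ((∀ x, v' (Sum.inl x) = 0) ∧ v' (Sum.inr 0) ≠ 0)) :=
  AbelianTwoBlock.exists_zLogical_pinned (coeffVec C.A) (coeffVec C.B) hv hv'

/-- **Translation-orbit lemma for `QC(A, B)`, `X`-side** (`H^Z v = 0`, `v ∉ rs H^X`).
[cite: BravyiEtAl2024, SI §9.2 (arXiv:2308.07915, chunk p0021 L60 – p0022 L12)] -/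
theorem exists_xLogical_pinned {v : Mono ℓ m ⊕ Mono ℓ m → ZMod 2} (hv : C.HZ *ᵥ v = 0)
    (hv' : v ∉ rowSpace C.HX) :
    ∃ v', C.HZ *ᵥ v' = 0 ∧ v' ∉ rowSpace C.HX ∧ hammingNorm v' = hammingNorm v ∧
      (v' (Sum.inl 0) ≠ 0 ∨ ((∀ x, v' (Sum.inl x) = 0) ∧ v' (Sum.inr 0) ≠ 0)) :=
  AbelianTwoBlock.exists_xLogical_pinned (coeffVec C.A) (coeffVec C.B) hv hv'

/-- **Pinned lower bound for `d^Z` of `QC(A, B)`**: if a `Z`-logical exists and every PINNED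
`Z`-logical has weight `≥ d`, then `d ≤ d^Z`.
[cite: BravyiEtAl2024, SI §9.2 (arXiv:2308.07915, chunk p0021 L60 – p0022 L12)] -/
theorem le_dZ_of_pinned {d : ℕ}
    (hex : ∃ v : Mono ℓ m ⊕ Mono ℓ m → ZMod 2, C.HX *ᵥ v = 0 ∧ v ∉ rowSpace C.HZ)
    (h : ∀ v : Mono ℓ m ⊕ Mono ℓ m → ZMod 2, C.HX *ᵥ v = 0 → v ∉ rowSpace C.HZ →
      (v (Sum.inl 0) ≠ 0 ∨ ((∀ x, v (Sum.inl x) = 0) ∧ v (Sum.inr 0) ≠ 0)) → d ≤ hammingNorm v) :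
    d ≤ C.css.dZ :=
  C.css.le_dZ hex (AbelianTwoBlock.le_hammingNorm_zLogical_of_pinned (coeffVec C.A) (coeffVec C.B) h)

/-- **Pinned lower bound for `d^X` of `QC(A, B)`.**
[cite: BravyiEtAl2024, SI §9.2 (arXiv:2308.07915, chunk p0021 L60 – p0022 L12)] -/
theorem le_dX_of_pinned {d : ℕ}
    (hex : ∃ v : Mono ℓ m ⊕ Mono ℓ m → ZMod 2, C.HZ *ᵥ v = 0 ∧ v ∉ rowSpace C.HX)
    (h : ∀ v : Mono ℓ m ⊕ Mono ℓ m → ZMod 2, C.HZ *ᵥ v = 0 → v ∉ rowSpace C.HX →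
      (v (Sum.inl 0) ≠ 0 ∨ ((∀ x, v (Sum.inl x) = 0) ∧ v (Sum.inr 0) ≠ 0)) → d ≤ hammingNorm v) :
    d ≤ C.css.dX :=
  C.css.le_dX hex (AbelianTwoBlock.le_hammingNorm_xLogical_of_pinned (coeffVec C.A) (coeffVec C.B) h)

/-- **The pinned certificate lemma for `d^Z` of `QC(A, B)`**: an explicit `Z`-logical `v` of weight `d`
plus "every pinned `Z`-logical has weight `≥ d`" gives `d^Z = d`.
[cite: BravyiEtAl2024, SI §9.2 (arXiv:2308.07915, chunk p0021 L60 – p0022 L12)] -/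
theorem dZ_eq_of_pinned_witness {d : ℕ} {v : Mono ℓ m ⊕ Mono ℓ m → ZMod 2} (hv : C.HX *ᵥ v = 0)
    (hv' : v ∉ rowSpace C.HZ) (hwt : hammingNorm v = d)
    (h : ∀ w : Mono ℓ m ⊕ Mono ℓ m → ZMod 2, C.HX *ᵥ w = 0 → w ∉ rowSpace C.HZ →
      (w (Sum.inl 0) ≠ 0 ∨ ((∀ x, w (Sum.inl x) = 0) ∧ w (Sum.inr 0) ≠ 0)) → d ≤ hammingNorm w) :
    C.css.dZ = d :=
  le_antisymm (hwt ▸ C.css.dZ_le_hammingNorm hv hv') (C.le_dZ_of_pinned ⟨v, hv, hv'⟩ h)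

/-- **The pinned certificate lemma for `d^X` of `QC(A, B)`.**
[cite: BravyiEtAl2024, SI §9.2 (arXiv:2308.07915, chunk p0021 L60 – p0022 L12)] -/
theorem dX_eq_of_pinned_witness {d : ℕ} {v : Mono ℓ m ⊕ Mono ℓ m → ZMod 2} (hv : C.HZ *ᵥ v = 0)
    (hv' : v ∉ rowSpace C.HX) (hwt : hammingNorm v = d)
    (h : ∀ w : Mono ℓ m ⊕ Mono ℓ m → ZMod 2, C.HZ *ᵥ w = 0 → w ∉ rowSpace C.HX →
      (w (Sum.inl 0) ≠ 0 ∨ ((∀ x, w (Sum.inl x) = 0) ∧ w (Sum.inr 0) ≠ 0)) → d ≤ hammingNorm w) :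
    C.css.dX = d :=
  le_antisymm (hwt ▸ C.css.dX_le_hammingNorm hv hv') (C.le_dX_of_pinned ⟨v, hv, hv'⟩ h)

/-- **The pinned certificate lemma for the distance `d` of `QC(A, B)`** (`d = d^Z` by
[BravyiEtAl2024, Lemma 1], `BB.Code.d_eq_dZ`): an explicit `Z`-logical of weight `d` plus "every pinned
`Z`-logical has weight `≥ d`" gives `C.d = d` — the shape of a translation-pinned distance certificate
for `[[72,12,6]]`, `[[144,12,12]]`, ….
[cite: BravyiEtAl2024, Lemma 1 and SI §9.2 (arXiv:2308.07915, chunk p0009 L74–77; p0021 L60 – p0022 L12)] -/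
theorem d_eq_of_pinned_witness {d : ℕ} {v : Mono ℓ m ⊕ Mono ℓ m → ZMod 2} (hv : C.HX *ᵥ v = 0)
    (hv' : v ∉ rowSpace C.HZ) (hwt : hammingNorm v = d)
    (h : ∀ w : Mono ℓ m ⊕ Mono ℓ m → ZMod 2, C.HX *ᵥ w = 0 → w ∉ rowSpace C.HZ →
      (w (Sum.inl 0) ≠ 0 ∨ ((∀ x, w (Sum.inl x) = 0) ∧ w (Sum.inr 0) ≠ 0)) → d ≤ hammingNorm w) :
    C.d = d := by
  rw [d_eq_dZ]
  exact C.dZ_eq_of_pinned_witness hv hv' hwt h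

/-- Existence form for `QC(A, B)`: a `Z`-logical of weight `≤ w` exists iff a pinned one does (the
case split of a kernel-B SAT certificate: UNSAT of both pinned cases ⇒ no `Z`-logical of weight `≤ w`).
[cite: BravyiEtAl2024, SI §9.2 (arXiv:2308.07915, chunk p0021 L60 – p0022 L12)] -/
theorem exists_zLogical_hammingNorm_le_iff_pinned (w : ℕ) :
    (∃ v : Mono ℓ m ⊕ Mono ℓ m → ZMod 2, C.HX *ᵥ v = 0 ∧ v ∉ rowSpace C.HZ ∧ hammingNorm v ≤ w) ↔
      ∃ v : Mono ℓ m ⊕ Mono ℓ m → ZMod 2, C.HX *ᵥ v = 0 ∧ v ∉ rowSpace C.HZ ∧ hammingNorm v ≤ w ∧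
        (v (Sum.inl 0) ≠ 0 ∨ ((∀ x, v (Sum.inl x) = 0) ∧ v (Sum.inr 0) ≠ 0)) :=
  AbelianTwoBlock.exists_zLogical_hammingNorm_le_iff_pinned (coeffVec C.A) (coeffVec C.B) w

/-- **No pinned `Z`-logical of weight `< d` and one `Z`-logical of weight `d` ⇒ `C.d = d`**, phrased
with the NON-EXISTENCE of light pinned logicals (the UNSAT form a solver certificate delivers).
[cite: BravyiEtAl2024, Lemma 1 and SI §9.2 (arXiv:2308.07915, chunk p0009 L74–77; p0021 L60 – p0022 L12)] -/
theorem d_eq_of_witness_of_not_exists_pinned {d : ℕ} {v : Mono ℓ m ⊕ Mono ℓ m → ZMod 2}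
    (hv : C.HX *ᵥ v = 0) (hv' : v ∉ rowSpace C.HZ) (hwt : hammingNorm v = d)
    (h : ¬ ∃ w : Mono ℓ m ⊕ Mono ℓ m → ZMod 2, C.HX *ᵥ w = 0 ∧ w ∉ rowSpace C.HZ ∧
      hammingNorm w < d ∧ (w (Sum.inl 0) ≠ 0 ∨ ((∀ x, w (Sum.inl x) = 0) ∧ w (Sum.inr 0) ≠ 0))) :
    C.d = d :=
  C.d_eq_of_pinned_witness hv hv' hwt fun w hw hw' hpin =>
    not_lt.1 fun hlt => h ⟨w, hw, hw', hlt, hpin⟩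

end BB.Code

end Literature.InformationTheory.QuantumCodes
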